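import Literature.MathematicalPhysics.QuantumFieldTheory.WilsonEnergyConvexity
import Literature.MathematicalPhysics.QuantumFieldTheory.YangMillsOS
import HarnessLib

/-!
# Equipartition upper bound from the doubling of the fixed-torus partition function

Crux `FemtoCurvatureTwoPoint` (stmt-QuantumFields-9363, route `LangevinControlUV`), line
`generic-step-gamma-encoding`, blueprint step (B7): the first-moment ("equipartition") upper bound

  `β · ⟨S⟩_{L,β} ≤ A · L⁴`   for `β ≥ B(L)`, ONE `A` for all tori,

is a two-line consequence of the DOUBLING `Z_L(β/2) ≤ e^{A' L⁴} Z_L(β)` (skeleton statement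
`FixedTorusDoubling`, stub `stub_doubling_of_RV`, itself from the named fact
`WilsonPartitionRegularVariation`) and the Gibbs–Jensen supporting-line inequality of the tree
(`Literature.MathematicalPhysics.QuantumFieldTheory.mul_wilsonExpectation_wilsonAction_le`:
`(β − β')⟨S⟩_β ≤ log Z(β') − log Z(β)`), taken at `β' = β/2`. This is the typed fact `U₁ =
EquipartitionUpper` of the DU₂ stub analysis (worker note, 2026-08-16), here named
`EquipartitionUpperFixedTorus`; with the doubling it makes the variance rung of DU₂ on dyadic tori
(chessboard route) and the first-moment rung on ALL tori conditional only on the regular variation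
of `Z_L`.

## Main results

* `stub_equipartitionOfDoubling` (registered helper stub of crux stmt-QuantumFields-9363) : doubling ⇒ `∃ A, ∀ L, ∃ B, ∀ β ≥ B, β⟨S⟩_{L,β} ≤ A L⁴` (per
  compact `G` and lattice representation `r`), with `A = 2 max A' 0`.
-/

noncomputable section

open MeasureTheory Filter Topology
open Literature.MathematicalPhysics.QuantumLattice (torusLogPartition)

namespace Summit.QuantumFields.YangMills.Theorems.FemtoCurvatureTwoPoint

open Literature.MathematicalPhysics.QuantumFieldTheory

/-- **Doubling ⇒ equipartition.** If `Z_L(β/2) ≤ e^{A' L⁴} Z_L(β)` for `β ≥ B(L)` (the skeleton's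
`FixedTorusDoubling`, spelt out), then `β ⟨S⟩_{L,β} ≤ 2 max(A', 0) · L⁴` for `β ≥ B(L)`: the
Gibbs–Jensen inequality `(β − β/2) ⟨S⟩_β ≤ log Z(β/2) − log Z(β)` and `log` of the doubling. -/
theorem stub_equipartitionOfDoubling :
    (∀ (G : Type) [Group G] [TopologicalSpace G] [IsTopologicalGroup G] [CompactSpace G]
        [MeasurableSpace G] [BorelSpace G] (r : LatticeRep G), ∃ A : ℝ, ∀ (L : ℕ) [NeZero L],
      ∃ B : ℝ, ∀ β : ℝ, B ≤ β →
        (partitionFunction (d := 4) (L := L) r.ρ (β / 2)).toReal ≤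
          Real.exp (A * (L : ℝ) ^ 4) * (partitionFunction (d := 4) (L := L) r.ρ β).toReal) →
    ∀ (G : Type) [Group G] [TopologicalSpace G] [IsTopologicalGroup G] [CompactSpace G]
        [MeasurableSpace G] [BorelSpace G] (r : LatticeRep G), ∃ A : ℝ, ∀ (L : ℕ) [NeZero L],
      ∃ B : ℝ, ∀ β : ℝ, B ≤ β →
        β * wilsonExpectation (d := 4) (L := L) r.ρ β (wilsonAction (d := 4) (L := L) r.ρ) ≤
          A * (L : ℝ) ^ 4 := by
  intro hD G _ _ _ _ _ _ r
  obtain ⟨A, hA⟩ := hD G r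
  refine ⟨2 * max A 0, fun L _ => ?_⟩
  obtain ⟨B, hB⟩ := hA L
  refine ⟨B, fun β hβ => ?_⟩
  have hdbl := hB β hβ
  -- both partition functions are positive reals
  have hZ : ∀ b : ℝ, 0 < (partitionFunction (d := 4) (L := L) r.ρ b).toReal := fun b => by
    rw [partitionFunction_toReal_eq_integral r.ρ r.continuous b]
    exact integral_exp_neg_mul_wilsonAction_pos r.ρ r.continuous b
  -- `log Z(β/2) - log Z(β) ≤ A L⁴`
  have hlog : torusLogPartition 4 r.ρ (β / 2) L - torusLogPartition 4 r.ρ β L ≤ A * (L : ℝ) ^ 4 := by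
    have h1 : Real.log (partitionFunction (d := 4) (L := L) r.ρ (β / 2)).toReal ≤
        A * (L : ℝ) ^ 4 + Real.log (partitionFunction (d := 4) (L := L) r.ρ β).toReal := by
      have := Real.log_le_log (hZ (β / 2)) hdbl
      rwa [Real.log_mul (Real.exp_pos _).ne' (hZ β).ne', Real.log_exp] at this
    simp only [torusLogPartition]
    linarith
  -- Gibbs–Jensen at `β' = β/2`
  have hGJ := mul_wilsonExpectation_wilsonAction_le (d := 4) (L := L) (G := G) r.ρ r.continuous β (β / 2)
  have hhalf : (β - β / 2) = β / 2 := by ring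
  rw [hhalf] at hGJ
  have hL4 : (0 : ℝ) ≤ (L : ℝ) ^ 4 := by positivity
  have hAmax : A * (L : ℝ) ^ 4 ≤ max A 0 * (L : ℝ) ^ 4 :=
    mul_le_mul_of_nonneg_right (le_max_left _ _) hL4
  calc β * wilsonExpectation (d := 4) (L := L) r.ρ β (wilsonAction (d := 4) (L := L) r.ρ)
      = 2 * (β / 2 * wilsonExpectation (d := 4) (L := L) r.ρ β (wilsonAction (d := 4) (L := L) r.ρ)) := by
        ring
    _ ≤ 2 * (torusLogPartition 4 r.ρ (β / 2) L - torusLogPartition 4 r.ρ β L) :=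
        mul_le_mul_of_nonneg_left hGJ (by norm_num)
    _ ≤ 2 * (max A 0 * (L : ℝ) ^ 4) := mul_le_mul_of_nonneg_left (hlog.trans hAmax) (by norm_num)
    _ = 2 * max A 0 * (L : ℝ) ^ 4 := by ring

end Summit.QuantumFields.YangMills.Theorems.FemtoCurvatureTwoPoint

end
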